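import Mathlib
import Summits.Ventures.DiscreteObjects.Mahler.CyclotomicFieldIntegersLehmer
import Summits.Ventures.DiscreteObjects.Mahler.CyclotomicIntegerSchinzelMeasure
import Summits.Ventures.DiscreteObjects.Mahler.CyclotomicIntegerLehmerTwo

/-!
# Schinzel's bound for the ring of integers of every cyclotomic field (venture `DiscreteObjects`, target L)

Cell `pub-namedobj`, seat `pub-namedobj-mahler-g28`. Framing: lottery ticket; floor = certified bounds/negative ranges.

The presentation-free forms (`α` any algebraic integer of `ℚ(ζ_m) ⊂ ℂ`, via `𝓞_{ℚ(ζ_m)} = ℤ[ζ_m]`,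
`CyclotomicFieldIntegersLehmer.exists_aeval_eq_of_isIntegral_of_mem_adjoin`) of the bounds landed for `α = g(ζ_m)`:
Schinzel 1973 (CM case) **`φ^{deg α} ≤ M(α)²`** and `M(α) ≥ φ` in degree `≥ 2` (`CyclotomicIntegerSchinzelMeasure`), and the
2-adic bound `2^{deg α} ≤ M(α)^6` (`CyclotomicIntegerLehmerTwo`; Amoroso–Dvornicich), next to [cite: BombieriGubler2001,
Theorem 4.4.9] (`lehmer_of_isIntegral_mem_cyclotomicField`).  Bookkeeping; no new mathematics.
-/

namespace Summit.Ventures.DiscreteObjects.Mahler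

open Polynomial

/-- **Schinzel's theorem for the algebraic integers of a cyclotomic field**: `α ∈ ℚ(ζ_m)` an algebraic integer, `α ≠ 0`
not a root of unity ⇒ `φ^{deg α} ≤ M(α)²`, and `φ ≤ M(α)` when `deg α ≥ 2`. -/
theorem schinzel_of_isIntegral_mem_cyclotomicField {m : ℕ} (hm : 0 < m) {ζ : ℂ} (hζ : IsPrimitiveRoot ζ m) {α : ℂ}
    (hα : α ∈ IntermediateField.adjoin ℚ {ζ}) (hint : IsIntegral ℤ α) (h0 : α ≠ 0)
    (hnu : ∀ k : ℕ, 0 < k → α ^ k ≠ 1) :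
    Real.goldenRatio ^ (minpoly ℤ α).natDegree ≤ intMahlerMeasure (minpoly ℤ α) ^ 2 ∧
      (2 ≤ (minpoly ℤ α).natDegree → Real.goldenRatio ≤ intMahlerMeasure (minpoly ℤ α)) := by
  obtain ⟨g, rfl⟩ := exists_aeval_eq_of_isIntegral_of_mem_adjoin hm hζ hα hint
  exact ⟨goldenRatio_pow_le_measure_sq hm g hζ h0 hnu, fun hd => goldenRatio_le_measure hm g hζ h0 hnu hd⟩

/-- The 2-adic bound for the algebraic integers of a cyclotomic field: `2^{deg α} ≤ M(α)^6`. -/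
theorem two_pow_le_measure_pow_six_of_isIntegral_mem_cyclotomicField {m : ℕ} (hm : 0 < m) {ζ : ℂ}
    (hζ : IsPrimitiveRoot ζ m) {α : ℂ} (hα : α ∈ IntermediateField.adjoin ℚ {ζ}) (hint : IsIntegral ℤ α) (h0 : α ≠ 0)
    (hnu : ∀ k : ℕ, 0 < k → α ^ k ≠ 1) :
    (2 : ℝ) ^ (minpoly ℤ α).natDegree ≤ intMahlerMeasure (minpoly ℤ α) ^ 6 := by
  obtain ⟨g, rfl⟩ := exists_aeval_eq_of_isIntegral_of_mem_adjoin hm hζ hα hint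
  exact cyclotomicInteger_lehmer_bound_two hm g hζ h0 hnu

end Summit.Ventures.DiscreteObjects.Mahler
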